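import Summits.QuantumFields.BalabanUV.T4Continuum.Support.NE7GaugeSliceMapFacts
import Summits.QuantumFields.BalabanUV.T4Continuum.Support.NE7LocalSlice
import HarnessLib

/-!
# NE7GaugeSliceInstance — THE GAUGE SLICE THROUGH A BASE CONFIGURATION IN THE TORUS CHART (ROAD-G114 §9 (S2)): for a unitary `M`-periodic `W` (`M = L·tower L N j`) there are a linear
# slice `Σ ≤ skewSub M` and `C²` maps `ξ` (skew box site fields with TRIVIAL CORNERS) and `σ` (values in `Σ`), zero at `0`, such that every chart parameter `Φ` near `0` is
# `Φ = A(ξ(Φ), σ(Φ))`, `A(ζ,Φ) := skewPR M (relLog M W ((chart_W Φ)^{exp ζ}))`, uniquely among small trivial-corner skew `ζ` and small `σ ∈ Σ`; and `Σ` is a COMPLEMENT of the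
# linearised gauge directions `skewPR(∇̃_W ζ)` (`∇̃_Wζ(r,κ) = W(b)⁻¹ζ(r)W(b) − ζ(r+e_κ)`), on which the linearisation is injective — `NE7LocalSlice.local_slice` (✓ p823307) instantiated
# with `NE7GaugeActionChart` (✓ p823279) and `NE7GaugeSliceMapFacts` (✓∕pending p823513)

Cell `pub-balaban`, rung (B)+1 sub-cell t4, lineage `b2b-balaban-t4-ne7-p1` (CRUX PROVER NE7 #1 = OWNER of BINDER row NE7), generation 114.  Memo `t4/b2b-balaban-t4-ne7-p1-g114/ROAD-G114.md` §9.
WHAT ([folklore]; 0 def, 0 sorry; `d = 4`).  **`gauge_slice`** (statement in the theorem's docstring).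
HONEST FRAMING (page 1): soft finite-dimensional calculus and linear algebra over landed letters; radii∕neighbourhoods existential; nothing of Bałaban's (his slice is the axial gauge); NOT NE7,
NOT NE3; spine 0∕9; finite T⁴ rung (B)+1 — NOT infinite volume, NOT mass gap, NOT BetaPertH, NOT Clay.
-/

set_option autoImplicit false

open scoped BigOperators Matrix Matrix.Norms.L2Operator Topology
open NormedSpace Finset Set Filter

namespace Summit.QuantumFields.BalabanUV.T4Continuum.NE7GaugeSliceInstance

open Literature.MathematicalPhysics.QuantumFieldTheory.Balaban1983to89
open B7Prop1Explicit B7Prop2Explicit MatrixLog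
open T4AveragingDeficitWall (IsUnitaryCfg)
open T4AveragingDeficitWallBoundary (IsPeriodicCfg)
open AveragingDeficitTorusChart (TDir chart redN)
open AveragingDeficitChartCalculus (relLog)
open AveragingDeficitTwoLevelPrep (skewSub skewPR skewPF skewPF_of_mem skewPF_apply)
open AveragingDeficitMultiLevelPrep (tower tower_ne_zero)
open NE7DatumCoordinateStabiliser (inv_mem_unitary)
open NE7GaugeActionChart (contDiffAt_gaugeChart gaugeChart_zero fderiv_gaugeChart_apply)
open NE7GaugeSliceMapFacts (covDeriv_injective_trivialCorner)
open NE7LocalSlice (local_slice)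

noncomputable section

variable {n : Type} [Fintype n] [DecidableEq n]

omit [DecidableEq n] in
/-- `skewPR` is the identity on `skewSub` (as an element). [folklore] -/
theorem skewPR_coe_self {M : ℕ} (Φ : ↥(skewSub 4 n M)) : skewPR M (Φ : TDir 4 n M) = Φ := by
  apply Subtype.ext
  show skewPF M (Φ : TDir 4 n M) = (Φ : TDir 4 n M)
  exact skewPF_of_mem Φ.2

omit [DecidableEq n] in
/-- `skewPR X = 0` for a skew field `X` forces `X = 0`. [folklore] -/
theorem eq_zero_of_skewPR_eq_zero {M : ℕ} {X : TDir 4 n M} (hX : X ∈ skewSub 4 n M) (h : skewPR M X = 0) : X = 0 := by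
  have h1 : ((skewPR M X : ↥(skewSub 4 n M)) : TDir 4 n M) = 0 := by rw [h]; rfl
  have h2 : ((skewPR M X : ↥(skewSub 4 n M)) : TDir 4 n M) = skewPF M X := rfl
  rw [h2, skewPF_of_mem hX] at h1
  exact h1

set_option maxHeartbeats 1600000 in
/-- **THE GAUGE SLICE THROUGH `W` (trivial-corner gauges).**  `W` unitary, `M = L·tower L N j`, corner scale `L^{j+1}`.  THEN there are a submodule `Σ` of
`skewSub M`, maps `ξ : skewSub M → ((Fin 4 → Fin M) → 𝕄)` and `σ : skewSub M → skewSub M`, both `C²` at `0` and zero at `0`, with: `ξ Φ` skew with trivial corners and `σ Φ ∈ Σ` for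
all `Φ`; `∀ᶠ Φ, A(ξ Φ, σ Φ) = Φ`; uniqueness `∀ᶠ (ζ, τ) → 0` among skew trivial-corner `ζ` and `τ ∈ Σ`: `ξ(A(ζ,τ)) = ζ ∧ σ(A(ζ,τ)) = τ`; every `v ∈ skewSub M` is `skewPR(∇̃_Wζ) + τ` with
such `ζ` and `τ ∈ Σ`; and `skewPR(∇̃_Wζ) ∈ Σ` forces `ζ = 0`. [folklore] -/
theorem gauge_slice [Nonempty n] {L N : ℕ} [NeZero L] [NeZero N] (j : ℕ) {W : Site 4 → Fin 4 → (Matrix n n ℂ)ˣ} (hWu : IsUnitaryCfg W) :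
    ∃ (Sg : Submodule ℝ ↥(skewSub 4 n (L * tower L N j))) (ξ : ↥(skewSub 4 n (L * tower L N j)) → ((Fin 4 → Fin (L * tower L N j)) → Matrix n n ℂ))
      (σ : ↥(skewSub 4 n (L * tower L N j)) → ↥(skewSub 4 n (L * tower L N j))),
      ContDiffAt ℝ 2 ξ 0 ∧ ContDiffAt ℝ 2 σ 0 ∧ ξ 0 = 0 ∧ σ 0 = 0 ∧
      (∀ Φ, (∀ r, ξ Φ r ∈ skewAdjoint (Matrix n n ℂ)) ∧ (∀ w : Site 4, ξ Φ (redN (L * tower L N j) (((L : ℤ) ^ (j + 1)) • w)) = 0) ∧ σ Φ ∈ Sg) ∧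
      (∀ᶠ Φ : ↥(skewSub 4 n (L * tower L N j)) in 𝓝 0,
        skewPR (L * tower L N j) (relLog (L * tower L N j) W (gaugeAct (fun x : Site 4 => expUnit (ξ Φ (redN (L * tower L N j) x)))
          (chart (ContinuousLinearMap.id ℝ (Matrix n n ℂ)) (L * tower L N j) W (σ Φ : TDir 4 n (L * tower L N j))))) = Φ) ∧
      (∀ᶠ p : ((Fin 4 → Fin (L * tower L N j)) → Matrix n n ℂ) × ↥(skewSub 4 n (L * tower L N j)) in 𝓝 0,
        (∀ r, p.1 r ∈ skewAdjoint (Matrix n n ℂ)) → (∀ w : Site 4, p.1 (redN (L * tower L N j) (((L : ℤ) ^ (j + 1)) • w)) = 0) → p.2 ∈ Sg →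
          ξ (skewPR (L * tower L N j) (relLog (L * tower L N j) W (gaugeAct (fun x : Site 4 => expUnit (p.1 (redN (L * tower L N j) x)))
              (chart (ContinuousLinearMap.id ℝ (Matrix n n ℂ)) (L * tower L N j) W (p.2 : TDir 4 n (L * tower L N j)))))) = p.1 ∧
          σ (skewPR (L * tower L N j) (relLog (L * tower L N j) W (gaugeAct (fun x : Site 4 => expUnit (p.1 (redN (L * tower L N j) x)))
              (chart (ContinuousLinearMap.id ℝ (Matrix n n ℂ)) (L * tower L N j) W (p.2 : TDir 4 n (L * tower L N j)))))) = p.2) ∧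
      (∀ v : ↥(skewSub 4 n (L * tower L N j)), ∃ (ζ : (Fin 4 → Fin (L * tower L N j)) → Matrix n n ℂ) (τ : ↥(skewSub 4 n (L * tower L N j))),
        (∀ r, ζ r ∈ skewAdjoint (Matrix n n ℂ)) ∧ (∀ w : Site 4, ζ (redN (L * tower L N j) (((L : ℤ) ^ (j + 1)) • w)) = 0) ∧ τ ∈ Sg ∧
        v = skewPR (L * tower L N j) (fun r κ => (((W (boxVec (L * tower L N j) r) κ)⁻¹ : (Matrix n n ℂ)ˣ) : Matrix n n ℂ) * ζ r * (W (boxVec (L * tower L N j) r) κ : Matrix n n ℂ)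
          - ζ (redN (L * tower L N j) (boxVec (L * tower L N j) r + e κ))) + τ) ∧
      (∀ ζ : (Fin 4 → Fin (L * tower L N j)) → Matrix n n ℂ, (∀ r, ζ r ∈ skewAdjoint (Matrix n n ℂ)) →
        (∀ w : Site 4, ζ (redN (L * tower L N j) (((L : ℤ) ^ (j + 1)) • w)) = 0) →
        skewPR (L * tower L N j) (fun r κ => (((W (boxVec (L * tower L N j) r) κ)⁻¹ : (Matrix n n ℂ)ˣ) : Matrix n n ℂ) * ζ r * (W (boxVec (L * tower L N j) r) κ : Matrix n n ℂ)
          - ζ (redN (L * tower L N j) (boxVec (L * tower L N j) r + e κ))) ∈ Sg → ζ = 0) := by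
  set M : ℕ := L * tower L N j with hMdef
  haveI : NeZero M := ⟨Nat.mul_ne_zero (NeZero.ne L) (tower_ne_zero L N j)⟩
  -- the Lie algebra of trivial-corner skew box fields, as a submodule
  set G₀ : Submodule ℝ ((Fin 4 → Fin M) → Matrix n n ℂ) :=
    { carrier := {ζ | (∀ r, ζ r ∈ skewAdjoint (Matrix n n ℂ)) ∧ ∀ w : Site 4, ζ (redN M (((L : ℤ) ^ (j + 1)) • w)) = 0}
      add_mem' := fun {a b} ha hb => ⟨fun r => (skewAdjoint (Matrix n n ℂ)).add_mem (ha.1 r) (hb.1 r), fun w => by simp only [Pi.add_apply, ha.2 w, hb.2 w, add_zero]⟩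
      zero_mem' := ⟨fun r => (skewAdjoint (Matrix n n ℂ)).zero_mem, fun w => rfl⟩
      smul_mem' := fun c ζ hζ => ⟨fun r => by simpa only [Pi.smul_apply] using skewAdjoint.smul_mem c (hζ.1 r), fun w => by simp only [Pi.smul_apply, hζ.2 w, smul_zero]⟩ }
    with hG₀
  have hG₀mem : ∀ ζ : (Fin 4 → Fin M) → Matrix n n ℂ, ζ ∈ G₀ ↔ (∀ r, ζ r ∈ skewAdjoint (Matrix n n ℂ)) ∧ ∀ w : Site 4, ζ (redN M (((L : ℤ) ^ (j + 1)) • w)) = 0 :=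
    fun ζ => Iff.rfl
  haveI hG₀fd : FiniteDimensional ℝ ↥G₀ := FiniteDimensional.finiteDimensional_submodule G₀
  haveI : FiniteDimensional ℝ (↥G₀ × ↥(skewSub 4 n M)) := Module.Finite.prod
  haveI : CompleteSpace (↥G₀ × ↥(skewSub 4 n M)) := FiniteDimensional.complete ℝ _
  -- the raw map and the slice map `A : G₀ × S → S`
  set Graw : ((Fin 4 → Fin M) → Matrix n n ℂ) × TDir 4 n M → TDir 4 n M := fun q =>
    relLog M W (gaugeAct (fun x : Site 4 => expUnit (q.1 (redN M x))) (chart (ContinuousLinearMap.id ℝ (Matrix n n ℂ)) M W q.2)) with hGraw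
  set ι : ↥G₀ × ↥(skewSub 4 n M) →L[ℝ] ((Fin 4 → Fin M) → Matrix n n ℂ) × TDir 4 n M := G₀.subtypeL.prodMap (skewSub 4 n M).subtypeL with hι
  set A : ↥G₀ × ↥(skewSub 4 n M) → ↥(skewSub 4 n M) := fun p => skewPR M (Graw (ι p)) with hA
  have hAval : ∀ (ζ : ↥G₀) (Φ : ↥(skewSub 4 n M)), A (ζ, Φ) = skewPR M (relLog M W (gaugeAct (fun x : Site 4 => expUnit ((ζ : (Fin 4 → Fin M) → Matrix n n ℂ) (redN M x)))
      (chart (ContinuousLinearMap.id ℝ (Matrix n n ℂ)) M W (Φ : TDir 4 n M)))) := fun _ _ => rfl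
  have hι0 : ι 0 = 0 := map_zero ι
  have hGc : ContDiffAt ℝ 2 Graw (ι 0) := by rw [hι0]; exact contDiffAt_gaugeChart (m := 2) M W
  have hAc : ContDiffAt ℝ 2 A 0 := (skewPR (d := 4) (n := n) M).contDiff.contDiffAt.comp 0 (hGc.comp 0 ι.contDiff.contDiffAt)
  have hGraw0 : Graw 0 = 0 := gaugeChart_zero M W
  have hA0 : A 0 = 0 := by
    show skewPR M (Graw (ι 0)) = 0
    rw [hι0, hGraw0, map_zero]
  -- the differential: `T = skewPR ∘ DGraw(0) ∘ ι`
  have hGd : HasFDerivAt Graw (fderiv ℝ Graw 0) (ι 0) := by rw [hι0]; exact (hGc.differentiableAt (by norm_num)).hasFDerivAt |>.congr_fderiv (by rw [hι0])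
  have hAd : HasFDerivAt A ((skewPR (d := 4) (n := n) M).comp ((fderiv ℝ Graw 0).comp ι)) 0 :=
    (skewPR (d := 4) (n := n) M).hasFDerivAt.comp 0 (hGd.comp 0 ι.hasFDerivAt)
  have hT : fderiv ℝ A 0 = (skewPR (d := 4) (n := n) M).comp ((fderiv ℝ Graw 0).comp ι) := hAd.fderiv
  -- its values on the two factors
  have hTval : ∀ (ζ : ↥G₀) (Φ : ↥(skewSub 4 n M)), (fderiv ℝ A 0) (ζ, Φ) = skewPR M (fun r κ => (Φ : TDir 4 n M) r κ
      + ((((W (boxVec M r) κ)⁻¹ : (Matrix n n ℂ)ˣ) : Matrix n n ℂ) * (ζ : (Fin 4 → Fin M) → Matrix n n ℂ) r * (W (boxVec M r) κ : Matrix n n ℂ)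
        - (ζ : (Fin 4 → Fin M) → Matrix n n ℂ) (redN M (boxVec M r + e κ)))) := by
    intro ζ Φ
    rw [hT]
    show skewPR M ((fderiv ℝ Graw 0) (ι (ζ, Φ))) = _
    congr 1
    funext r κ
    exact fderiv_gaugeChart_apply M W _ _ r κ
  -- (i) `∂_Φ A(0) = id`
  have hAΦ : (fderiv ℝ A 0).comp (ContinuousLinearMap.inr ℝ ↥G₀ ↥(skewSub 4 n M)) = ContinuousLinearMap.id ℝ ↥(skewSub 4 n M) := by
    ext Φ : 1
    simp only [ContinuousLinearMap.coe_comp, Function.comp_apply, ContinuousLinearMap.inr_apply, ContinuousLinearMap.coe_id', id]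
    rw [hTval]
    have e : (fun r κ => (Φ : TDir 4 n M) r κ + ((((W (boxVec M r) κ)⁻¹ : (Matrix n n ℂ)ˣ) : Matrix n n ℂ) * ((0 : ↥G₀) : (Fin 4 → Fin M) → Matrix n n ℂ) r
        * (W (boxVec M r) κ : Matrix n n ℂ) - ((0 : ↥G₀) : (Fin 4 → Fin M) → Matrix n n ℂ) (redN M (boxVec M r + e κ)))) = (Φ : TDir 4 n M) := by
      funext r κ; simp
    rw [e, skewPR_coe_self]
  -- (ii) the gauge directions: `Dζ̇ = skewPR(∇̃ζ̇)`, injective on trivial-corner skew fields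
  have hDval : ∀ ζ : ↥G₀, ((fderiv ℝ A 0).comp (ContinuousLinearMap.inl ℝ ↥G₀ ↥(skewSub 4 n M))) ζ = skewPR M (fun r κ =>
      (((W (boxVec M r) κ)⁻¹ : (Matrix n n ℂ)ˣ) : Matrix n n ℂ) * (ζ : (Fin 4 → Fin M) → Matrix n n ℂ) r * (W (boxVec M r) κ : Matrix n n ℂ)
        - (ζ : (Fin 4 → Fin M) → Matrix n n ℂ) (redN M (boxVec M r + e κ))) := by
    intro ζ
    simp only [ContinuousLinearMap.coe_comp, Function.comp_apply, ContinuousLinearMap.inl_apply]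
    rw [hTval]
    congr 1
    funext r κ
    simp
  have hcovskew : ∀ ζ : (Fin 4 → Fin M) → Matrix n n ℂ, (∀ r, ζ r ∈ skewAdjoint (Matrix n n ℂ)) →
      (fun r κ => (((W (boxVec M r) κ)⁻¹ : (Matrix n n ℂ)ˣ) : Matrix n n ℂ) * ζ r * (W (boxVec M r) κ : Matrix n n ℂ) - ζ (redN M (boxVec M r + e κ))) ∈ skewSub 4 n M := by
    intro ζ hζ r κ
    have hinv : (((W (boxVec M r) κ)⁻¹ : (Matrix n n ℂ)ˣ) : Matrix n n ℂ) = star (W (boxVec M r) κ : Matrix n n ℂ) :=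
      Units.inv_eq_of_mul_eq_one_left (Unitary.star_mul_self_of_mem (mem_unitaryUnits.mp (hWu _ _)))
    show (((W (boxVec M r) κ)⁻¹ : (Matrix n n ℂ)ˣ) : Matrix n n ℂ) * ζ r * (W (boxVec M r) κ : Matrix n n ℂ) - ζ (redN M (boxVec M r + e κ)) ∈ skewAdjoint (Matrix n n ℂ)
    rw [hinv]
    exact (skewAdjoint (Matrix n n ℂ)).sub_mem (skewAdjoint.conjugate' (hζ r) _) (hζ _)
  have hinjraw : ∀ ζ : (Fin 4 → Fin M) → Matrix n n ℂ, (∀ r, ζ r ∈ skewAdjoint (Matrix n n ℂ)) → (∀ w : Site 4, ζ (redN M (((L : ℤ) ^ (j + 1)) • w)) = 0) →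
      skewPR M (fun r κ => (((W (boxVec M r) κ)⁻¹ : (Matrix n n ℂ)ˣ) : Matrix n n ℂ) * ζ r * (W (boxVec M r) κ : Matrix n n ℂ) - ζ (redN M (boxVec M r + e κ))) = 0 → ζ = 0 := by
    intro ζ hζ hc h
    have hz := eq_zero_of_skewPR_eq_zero (hcovskew ζ hζ) h
    exact covDeriv_injective_trivialCorner (L := L) (N := N) j W hc fun r κ => by
      have := congr_fun (congr_fun hz r) κ; simpa using this
  have hinj : ∀ ζ ∈ (⊤ : Submodule ℝ ↥G₀), ((fderiv ℝ A 0).comp (ContinuousLinearMap.inl ℝ ↥G₀ ↥(skewSub 4 n M))) ζ = 0 → ζ = 0 := by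
    intro ζ _ h
    rw [hDval] at h
    exact Subtype.ext (hinjraw _ ζ.2.1 ζ.2.2 h)
  -- (iii) a complement of the image
  obtain ⟨Sg, hSg⟩ := Submodule.exists_isCompl ((⊤ : Submodule ℝ ↥G₀).map
    ((((fderiv ℝ A 0).comp (ContinuousLinearMap.inl ℝ ↥G₀ ↥(skewSub 4 n M)) : ↥G₀ →L[ℝ] ↥(skewSub 4 n M)) : ↥G₀ →ₗ[ℝ] ↥(skewSub 4 n M))))
  -- THE ABSTRACT SLICE
  obtain ⟨ξ', σ', hξ'c, hσ'c, hξ'0, hσ'0, hright, hleft⟩ := local_slice hAc hA0 hAΦ ⊤ Sg hinj hSg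
  refine ⟨Sg, fun Φ => (((ξ' Φ : ↥(⊤ : Submodule ℝ ↥G₀)) : ↥G₀) : (Fin 4 → Fin M) → Matrix n n ℂ), fun Φ => ((σ' Φ : ↥Sg) : ↥(skewSub 4 n M)),
    ?_, ?_, by simp [hξ'0], by simp [hσ'0], fun Φ => ⟨((ξ' Φ : ↥(⊤ : Submodule ℝ ↥G₀)) : ↥G₀).2.1, ((ξ' Φ : ↥(⊤ : Submodule ℝ ↥G₀)) : ↥G₀).2.2, (σ' Φ).2⟩, ?_, ?_, ?_, ?_⟩
  · exact (G₀.subtypeL.contDiff.comp (⊤ : Submodule ℝ ↥G₀).subtypeL.contDiff).contDiffAt.comp 0 hξ'c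
  · exact Sg.subtypeL.contDiff.contDiffAt.comp 0 hσ'c
  · filter_upwards [hright] with Φ hΦ
    rw [← hAval] ; exact hΦ
  · -- uniqueness: pull back along the inclusion of `G₀ × Σ`
    rw [Metric.eventually_nhds_iff] at hleft ⊢
    obtain ⟨δ, hδ, hball⟩ := hleft
    refine ⟨δ, hδ, fun p hp hskew hcorner hmem => ?_⟩
    set q : ↥(⊤ : Submodule ℝ ↥G₀) × ↥Sg := (⟨⟨p.1, (hG₀mem p.1).mpr ⟨hskew, hcorner⟩⟩, trivial⟩, ⟨p.2, hmem⟩) with hq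
    have hqd : dist q 0 < δ := by
      have e1 : dist q 0 = dist p 0 := by
        simp only [hq, Prod.dist_eq, Subtype.dist_eq]
        rfl
      rw [e1]; exact hp
    have h := hball hqd
    have hA' : A (((q.1 : ↥(⊤ : Submodule ℝ ↥G₀)) : ↥G₀), (q.2 : ↥(skewSub 4 n M))) = skewPR M (relLog M W (gaugeAct (fun x : Site 4 => expUnit (p.1 (redN M x)))
        (chart (ContinuousLinearMap.id ℝ (Matrix n n ℂ)) M W (p.2 : TDir 4 n M)))) := rfl
    rw [hA'] at h
    refine ⟨?_, ?_⟩
    · have h1 := congrArg (fun z : ↥(⊤ : Submodule ℝ ↥G₀) => ((z : ↥G₀) : (Fin 4 → Fin M) → Matrix n n ℂ)) h.1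
      exact h1
    · have h2 := congrArg (fun z : ↥Sg => (z : ↥(skewSub 4 n M))) h.2
      exact h2
  · -- decomposition of every `v`
    intro v
    have hv : v ∈ (Submodule.map ((((fderiv ℝ A 0).comp (ContinuousLinearMap.inl ℝ ↥G₀ ↥(skewSub 4 n M)) : ↥G₀ →L[ℝ] ↥(skewSub 4 n M)) :
        ↥G₀ →ₗ[ℝ] ↥(skewSub 4 n M))) ⊤) ⊔ Sg := by
      rw [hSg.sup_eq_top]; exact Submodule.mem_top
    obtain ⟨a, ha, b, hb, hab⟩ := Submodule.mem_sup.mp hv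
    obtain ⟨ζ, -, hζ⟩ := Submodule.mem_map.mp ha
    refine ⟨((ζ : ↥G₀) : (Fin 4 → Fin M) → Matrix n n ℂ), b, ζ.2.1, ζ.2.2, hb, ?_⟩
    rw [← hab, ← hζ]
    congr 1
    exact hDval ζ
  · -- the slice meets the gauge directions only at `0`
    intro ζ hζ hc hmem
    have hin : skewPR M (fun r κ => (((W (boxVec M r) κ)⁻¹ : (Matrix n n ℂ)ˣ) : Matrix n n ℂ) * ζ r * (W (boxVec M r) κ : Matrix n n ℂ) - ζ (redN M (boxVec M r + e κ)))
        ∈ (⊤ : Submodule ℝ ↥G₀).map ((((fderiv ℝ A 0).comp (ContinuousLinearMap.inl ℝ ↥G₀ ↥(skewSub 4 n M)) : ↥G₀ →L[ℝ] ↥(skewSub 4 n M)) : ↥G₀ →ₗ[ℝ] ↥(skewSub 4 n M))) := by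
      refine Submodule.mem_map.mpr ⟨⟨ζ, (hG₀mem ζ).mpr ⟨hζ, hc⟩⟩, Submodule.mem_top, ?_⟩
      exact hDval ⟨ζ, (hG₀mem ζ).mpr ⟨hζ, hc⟩⟩
    have hzero : skewPR M (fun r κ => (((W (boxVec M r) κ)⁻¹ : (Matrix n n ℂ)ˣ) : Matrix n n ℂ) * ζ r * (W (boxVec M r) κ : Matrix n n ℂ) - ζ (redN M (boxVec M r + e κ))) = 0 := by
      have h := Submodule.mem_inf.mpr ⟨hin, hmem⟩
      rw [hSg.inf_eq_bot, Submodule.mem_bot] at h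
      exact h
    exact hinjraw ζ hζ hc hzero

end

end Summit.QuantumFields.BalabanUV.T4Continuum.NE7GaugeSliceInstance
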